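import Summits.KontsevichZagierPeriods.KontsevichZagierPeriods.Theorems.SoloBlindBetaBox
import Summits.KontsevichZagierPeriods.KontsevichZagierPeriods.Theorems.SoloBlindEllipticCells
import Summits.KontsevichZagierPeriods.KontsevichZagierPeriods.Theorems.SoloBlindTanHalf
import Summits.KontsevichZagierPeriods.KontsevichZagierPeriods.Theorems.SoloBlindDilogPieces
import Literature.NumberTheory.Transcendental.KZCalculusProofs
import Literature.NumberTheory.Transcendental.SemialgebraicLineDeriv
import HarnessLib

/-!
# Integrating the Legendre family over its modulus inside the rules, I: the modulus chart

The complete elliptic integrals `K(k) = ∫₀¹ dt/√((1-t²)(1-k²t²))` and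
`E(k) = ∫₀¹ √((1-k²t²)/(1-t²)) dt` (`SoloBlindEllipticCells`: `ellKf (k²)`, `ellEf (k²)`) have the
classical modulus integrals `∫₀¹ K(k) dk = 2G` and `∫₀¹ E(k) dk = G + 1/2`, `G` Catalan's
constant — usually obtained from the hypergeometric series of `K`, `E`, or from
`∫₀¹ dk/√(1-k²t²) = (arcsin t)/t`, both of which leave Kontsevich–Zagier's three rules (a series;
a transcendental primitive).  This file performs the integration over the modulus by ONE move of
rule (2): the `ℚ`-rational **modulus chart**

  `Φ(y, x) = ( y(1+x²)/(1+x²y²) , 2x/(1+x²) ) : (0,1)² → (0,1)²`     (a bijection)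

satisfies, with `S(u) = 2u/(1+u²)`, `C(u) = (1-u²)/(1+u²)`, `W(u) = 2/(1+u²)` (`SoloBlindTanHalf`)
and `(k, t) = Φ(y, x)`:  `t = S(x)`, `k·t = S(xy)`, hence `1 - t² = C(x)²`, `1 - k²t² = C(xy)²`,
and `|det DΦ| = (1+x²)(1-x²y²)/(1+x²y²)² · C(x)W(x)`, so that

  `dk dt/√((1-t²)(1-k²t²)) = W(xy) dy dx = 2 dy dx/(1+x²y²)`,
  `√((1-k²t²)/(1-t²)) dk dt = C(xy)² W(xy) dy dx = 2(1-x²y²)² dy dx/(1+x²y²)³`.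

This file: the chart, its derivative and Jacobian, bijectivity of `(0,1)² → (0,1)²`,
`ℚ`-semialgebraicity, and the two pulled-back forms (`tW_eq_ellKf_modChart_mul`,
`tC_sq_mul_tW_eq_ellEf_modChart_mul`).  The sequel `SoloBlindModulusCatalan` makes the two moves
of rule (2): `[(0,1)², 1/√((1-t²)(1-k²t²))] ≡ [(0,1)², 2/(1+x²y²)] = 2·[Bβ₂]` (value `2G`, so the
conjecture of Kontsevich–Zagier holds for that pair of rational representations of `2G`, a number
not known to be irrational) and `[(0,1)², √((1-k²t²)/(1-t²))] ≡ [(0,1)², 2(1-x²y²)²/(1+x²y²)³]`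
(value `G + 1/2`).

References: P. F. Byrd, M. D. Friedman, *Handbook of elliptic integrals* (1971), 615.01–615.14;
Y. Zhou, *Legendre functions, spherical rotations, and multiple elliptic integrals*,
arXiv:1301.2584, §2 (box-to-box rational maps for `4π²G`); M. Kontsevich, D. Zagier, *Periods*
(2001), §1.2.
-/

noncomputable section

namespace Summit.KontsevichZagierPeriods.KontsevichZagierPeriods.Theorems

open Set MeasureTheory
open Literature.ModelTheory.ExponentialFields (IsSemialgebraic)
open MvPolynomial (aeval X C)
open Literature.NumberTheory.Transcendental
open Literature.NumberTheory.Transcendental.KZ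

namespace SoloBlind

/-! ## The open unit square -/

/-- On `(0,1)²` both coordinates and their product lie in `(0,1)`. -/
theorem mem_kzOpenBox_two {p : Fin 2 → ℝ} (hp : p ∈ kzOpenBox 2) :
    (0 < p 0 ∧ p 0 < 1) ∧ (0 < p 1 ∧ p 1 < 1) ∧ 0 < p 0 * p 1 ∧ p 0 * p 1 < 1 := by
  have h0 := hp 0
  have h1 := hp 1
  exact ⟨⟨h0.1, h0.2⟩, ⟨h1.1, h1.2⟩, mul_pos h0.1 h1.1,
    mul_lt_one_of_nonneg_of_lt_one_left h0.1.le h0.2 h1.2.le⟩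

/-- A continuous function on the plane is integrable on `(0,1)²`. -/
theorem integrableOn_kzOpenBox_two_of_continuous {f : (Fin 2 → ℝ) → ℝ} (hf : Continuous f) :
    IntegrableOn f (kzOpenBox 2) :=
  (hf.continuousOn.integrableOn_compact isCompact_Icc).mono_set
    fun _ hx => ⟨fun i => (hx i).1.le, fun i => (hx i).2.le⟩

/-! ## The modulus chart -/

/-- The modulus chart `Φ(y, x) = (y(1+x²)/(1+x²y²), S(x))` (`p 0 = y`, `p 1 = x`). -/
def modChart (p : Fin 2 → ℝ) : Fin 2 → ℝ :=
  ![p 0 * (1 + p 1 ^ 2) / (1 + p 0 ^ 2 * p 1 ^ 2), tS (p 1)]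

/-- `∂k/∂y = (1+x²)(1-x²y²)/(1+x²y²)²`. -/
def modA (p : Fin 2 → ℝ) : ℝ :=
  (1 + p 1 ^ 2) * (1 - p 0 ^ 2 * p 1 ^ 2) / (1 + p 0 ^ 2 * p 1 ^ 2) ^ 2

/-- `∂k/∂x = 2xy(1-y²)/(1+x²y²)²`. -/
def modB (p : Fin 2 → ℝ) : ℝ := 2 * p 0 * p 1 * (1 - p 0 ^ 2) / (1 + p 0 ^ 2 * p 1 ^ 2) ^ 2

/-- `DΦ(p)` (upper triangular: `∂t/∂y = 0`, `∂t/∂x = C(x)W(x)`). -/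
def modDeriv (p : Fin 2 → ℝ) : (Fin 2 → ℝ) →L[ℝ] (Fin 2 → ℝ) :=
  ContinuousLinearMap.pi ![modA p • pr2 0 + modB p • pr2 1, (tC (p 1) * tW (p 1)) • pr2 1]

/-- `|det DΦ(p)| = (1+x²)(1-x²y²)/(1+x²y²)² · C(x)W(x)` on the square. -/
def modJac (p : Fin 2 → ℝ) : ℝ := modA p * (tC (p 1) * tW (p 1))

/-- `Φ` has derivative `DΦ` everywhere (its denominators never vanish). -/
theorem hasFDerivAt_modChart (p : Fin 2 → ℝ) : HasFDerivAt modChart (modDeriv p) p := by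
  have hπ0 : HasFDerivAt (fun q : Fin 2 → ℝ => q 0) (pr2 0) p := hasFDerivAt_apply 0 p
  have hπ1 : HasFDerivAt (fun q : Fin 2 → ℝ => q 1) (pr2 1) p := hasFDerivAt_apply 1 p
  have hD : (1 : ℝ) + p 0 ^ 2 * p 1 ^ 2 ≠ 0 := by positivity
  rw [hasFDerivAt_pi']
  refine Fin.forall_fin_two.mpr ⟨?_, ?_⟩
  · have hfun : (fun q : Fin 2 → ℝ => modChart q 0) =
        fun q => q 0 * (1 + q 1 ^ 2) * (1 + q 0 ^ 2 * q 1 ^ 2)⁻¹ := by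
      funext q; simp [modChart, div_eq_mul_inv]
    rw [hfun]
    have hsq0 := (hasDerivAt_pow 2 (p 0)).comp_hasFDerivAt p hπ0
    have hsq1 := (hasDerivAt_pow 2 (p 1)).comp_hasFDerivAt p hπ1
    have hN := hπ0.mul ((hasFDerivAt_const (1 : ℝ) p).add hsq1)
    have hDen := (hasFDerivAt_const (1 : ℝ) p).add (hsq0.mul hsq1)
    have hInv := (hasDerivAt_inv hD).comp_hasFDerivAt p hDen
    refine (hN.mul hInv).congr_fderiv (ContinuousLinearMap.ext fun v => ?_)
    simp [modDeriv, modA, modB]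
    field_simp
    ring
  · have hfun : (fun q : Fin 2 → ℝ => modChart q 1) = fun q => tS (q 1) := by
      funext q; simp [modChart]
    rw [hfun]
    refine ((hasDerivAt_tS (p 1)).comp_hasFDerivAt p hπ1).congr_fderiv
      (ContinuousLinearMap.ext fun v => ?_)
    simp [modDeriv]

/-- The matrix of `DΦ(p)`. -/
theorem toMatrix_modDeriv (p : Fin 2 → ℝ) :
    LinearMap.toMatrix' ((modDeriv p : (Fin 2 → ℝ) →L[ℝ] (Fin 2 → ℝ)) :
      (Fin 2 → ℝ) →ₗ[ℝ] (Fin 2 → ℝ)) = !![modA p, modB p; 0, tC (p 1) * tW (p 1)] := by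
  ext i j
  rw [LinearMap.toMatrix'_apply, ContinuousLinearMap.coe_coe]
  fin_cases i <;> fin_cases j <;> simp [modDeriv]

/-- `modA > 0` on the square. -/
theorem modA_pos {p : Fin 2 → ℝ} (hp : p ∈ kzOpenBox 2) : 0 < modA p := by
  obtain ⟨-, -, hu0, hu1⟩ := mem_kzOpenBox_two hp
  have h : 0 < 1 - p 0 ^ 2 * p 1 ^ 2 := by rw [← mul_pow]; nlinarith
  unfold modA
  positivity

/-- The Jacobian is positive on the square. -/
theorem modJac_pos {p : Fin 2 → ℝ} (hp : p ∈ kzOpenBox 2) : 0 < modJac p := by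
  obtain ⟨-, ⟨hx0, hx1⟩, -, -⟩ := mem_kzOpenBox_two hp
  exact mul_pos (modA_pos hp) (mul_pos (tC_pos hx0.le hx1) (tW_pos _))

/-- `|det DΦ(p)| = modJac p` on the square. -/
theorem abs_det_modDeriv {p : Fin 2 → ℝ} (hp : p ∈ kzOpenBox 2) :
    |(modDeriv p).det| = modJac p := by
  rw [ContinuousLinearMap.det, ← LinearMap.det_toMatrix', toMatrix_modDeriv, Matrix.det_fin_two_of]
  simp only [mul_zero, sub_zero]
  exact abs_of_pos (modJac_pos hp)

/-- `Φ` maps the square into itself. -/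
theorem modChart_mem {p : Fin 2 → ℝ} (hp : p ∈ kzOpenBox 2) : modChart p ∈ kzOpenBox 2 := by
  obtain ⟨⟨hy0, hy1⟩, ⟨hx0, hx1⟩, hu0, hu1⟩ := mem_kzOpenBox_two hp
  intro i
  fin_cases i
  · show p 0 * (1 + p 1 ^ 2) / (1 + p 0 ^ 2 * p 1 ^ 2) ∈ Ioo 0 1
    have hx2y : p 1 ^ 2 * p 0 < 1 := by nlinarith
    refine ⟨by positivity, ?_⟩
    rw [div_lt_one (by positivity)]
    nlinarith [mul_pos (sub_pos.2 hy1) (sub_pos.2 hx2y)]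
  · show tS (p 1) ∈ Ioo 0 1
    refine ⟨tS_pos hx0, ?_⟩
    rw [tS, div_lt_one (by positivity)]
    nlinarith [mul_pos (sub_pos.2 hx1) (sub_pos.2 hx1)]

/-- `Φ` is injective on the square. -/
theorem injOn_modChart : InjOn modChart (kzOpenBox 2) := by
  intro p hp p' hp' h
  obtain ⟨⟨hy0, hy1⟩, ⟨hx0, hx1⟩, -, -⟩ := mem_kzOpenBox_two hp
  obtain ⟨⟨hy0', hy1'⟩, ⟨hx0', hx1'⟩, -, -⟩ := mem_kzOpenBox_two hp'
  have h0 := congrFun h 0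
  have h1 := congrFun h 1
  simp only [modChart, Matrix.cons_val_zero, Matrix.cons_val_one, tS] at h0 h1
  have ex : p 1 = p' 1 := by
    rw [div_eq_div_iff (by positivity) (by positivity)] at h1
    have h2 : (p 1 - p' 1) * (1 - p 1 * p' 1) = 0 := by linear_combination h1 / 2
    rcases mul_eq_zero.1 h2 with h3 | h3
    · linarith
    · nlinarith [mul_pos hx0 hx0']
  rw [ex] at h0
  have ey : p 0 = p' 0 := by
    rw [div_eq_div_iff (by positivity) (by positivity)] at h0
    have h2 : (1 + p' 1 ^ 2) * ((p 0 - p' 0) * (1 - p' 1 ^ 2 * (p 0 * p' 0))) = 0 := by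
      linear_combination h0
    have h4 : (1 : ℝ) + p' 1 ^ 2 ≠ 0 := by positivity
    have h5 : 0 < 1 - p' 1 ^ 2 * (p 0 * p' 0) := by
      have hyy : p 0 * p' 0 < 1 := mul_lt_one_of_nonneg_of_lt_one_left hy0.le hy1 hy1'.le
      have hxx : p' 1 ^ 2 < 1 := pow_lt_one₀ hx0'.le hx1' two_ne_zero
      have : p' 1 ^ 2 * (p 0 * p' 0) < 1 :=
        mul_lt_one_of_nonneg_of_lt_one_left (sq_nonneg _) hxx hyy.le
      linarith
    rcases mul_eq_zero.1 h2 with h3 | h3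
    · exact absurd h3 h4
    · rcases mul_eq_zero.1 h3 with h6 | h6
      · linarith
      · linarith
  funext i
  fin_cases i
  · exact ey
  · exact ex

/-- `Φ((0,1)²) = (0,1)²` (surjectivity by the intermediate value theorem, coordinatewise). -/
theorem image_modChart : modChart '' kzOpenBox 2 = kzOpenBox 2 := by
  refine Subset.antisymm (image_subset_iff.2 fun p hp => modChart_mem hp) fun q hq => ?_
  obtain ⟨⟨hk0, hk1⟩, ⟨ht0, ht1⟩, -, -⟩ := mem_kzOpenBox_two hq
  have hSc : ContinuousOn tS (Icc 0 1) := fun u _ =>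
    (hasDerivAt_tS u).continuousAt.continuousWithinAt
  obtain ⟨x, hx, hxq⟩ : ∃ x ∈ Ioo (0 : ℝ) 1, tS x = q 1 := by
    have h := intermediate_value_Ioo (zero_le_one : (0 : ℝ) ≤ 1) hSc
    have h0 : tS 0 = 0 := by simp [tS]
    have h1 : tS 1 = 1 := by norm_num [tS]
    rw [h0, h1] at h
    exact h ⟨ht0, ht1⟩
  have hgc : ContinuousOn (fun y : ℝ => y * (1 + x ^ 2) / (1 + y ^ 2 * x ^ 2)) (Icc 0 1) :=
    (Continuous.div (by fun_prop) (by fun_prop) fun y =>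
      (by positivity : (0 : ℝ) < 1 + y ^ 2 * x ^ 2).ne').continuousOn
  obtain ⟨y, hy, hyq⟩ : ∃ y ∈ Ioo (0 : ℝ) 1, y * (1 + x ^ 2) / (1 + y ^ 2 * x ^ 2) = q 0 := by
    have h := intermediate_value_Ioo (zero_le_one : (0 : ℝ) ≤ 1) hgc
    have h1 : (1 : ℝ) * (1 + x ^ 2) / (1 + 1 ^ 2 * x ^ 2) = 1 := by
      rw [one_pow, one_mul, one_mul]; exact div_self (by positivity)
    simp only [zero_mul, zero_div, h1] at h
    exact h ⟨hk0, hk1⟩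
  refine ⟨![y, x], fun i => ?_, ?_⟩
  · fin_cases i
    · simpa using hy
    · simpa using hx
  · funext i
    fin_cases i
    · simpa [modChart] using hyq
    · simpa [modChart] using hxq

/-- `Φ` is a `ℚ`-rational, hence `ℚ`-semialgebraic, map on the square. -/
theorem isSemialgebraicMapOn_modChart : IsSemialgebraicMapOn ℚ (kzOpenBox 2) modChart := by
  have hS := isSemialgebraic_kzOpenBox 2
  refine IsSemialgebraicMapOn.of_forall hS fun i => ?_
  fin_cases i
  · exact (isSemialgebraicFunOn_aeval_div_aeval hS (X 0 * (1 + X 1 ^ 2)) (1 + X 0 ^ 2 * X 1 ^ 2)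
      fun p _ => by
        have : (0 : ℝ) < 1 + p 0 ^ 2 * p 1 ^ 2 := by positivity
        simpa using this.ne').congr fun p _ => by simp [modChart]
  · exact (isSemialgebraicFunOn_aeval_div_aeval hS (2 * X 1) (1 + X 1 ^ 2)
      fun p _ => by
        have : (0 : ℝ) < 1 + p 1 ^ 2 := by positivity
        simpa using this.ne').congr fun p _ => by simp [modChart, tS]

/-! ## What the chart does to the Legendre integrands -/

/-- `k · t = S(xy)`. -/
theorem modChart_zero_mul_one (p : Fin 2 → ℝ) : modChart p 0 * modChart p 1 = tS (p 0 * p 1) := by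
  have h1 : (1 : ℝ) + p 1 ^ 2 ≠ 0 := by positivity
  have h2 : (1 : ℝ) + p 0 ^ 2 * p 1 ^ 2 ≠ 0 := by positivity
  have h3 : (1 : ℝ) + (p 0 * p 1) ^ 2 ≠ 0 := by positivity
  simp only [modChart, Matrix.cons_val_zero, Matrix.cons_val_one, tS]
  field_simp

/-- `t = S(x)`. -/
theorem modChart_one (p : Fin 2 → ℝ) : modChart p 1 = tS (p 1) := by simp [modChart]

/-- `1/√((1-t²)(1-k²t²)) ∘ Φ = 1/(C(x)C(xy))`. -/
theorem ellKf_modChart {p : Fin 2 → ℝ} (hp : p ∈ kzOpenBox 2) :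
    ellKf (modChart p 0 ^ 2) (modChart p 1) = 1 / (tC (p 1) * tC (p 0 * p 1)) := by
  obtain ⟨-, ⟨hx0, hx1⟩, hu0, hu1⟩ := mem_kzOpenBox_two hp
  have hk : modChart p 0 ^ 2 * modChart p 1 ^ 2 = tS (p 0 * p 1) ^ 2 := by
    rw [← mul_pow, modChart_zero_mul_one]
  unfold ellKf
  rw [hk, modChart_one, one_sub_tS_sq, one_sub_tS_sq, ← mul_pow,
    Real.sqrt_sq (mul_pos (tC_pos hx0.le hx1) (tC_pos hu0.le hu1)).le]

/-- `√((1-k²t²)/(1-t²)) ∘ Φ = C(xy)/C(x)`. -/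
theorem ellEf_modChart {p : Fin 2 → ℝ} (hp : p ∈ kzOpenBox 2) :
    ellEf (modChart p 0 ^ 2) (modChart p 1) = tC (p 0 * p 1) / tC (p 1) := by
  obtain ⟨-, ⟨hx0, hx1⟩, hu0, hu1⟩ := mem_kzOpenBox_two hp
  have hk : modChart p 0 ^ 2 * modChart p 1 ^ 2 = tS (p 0 * p 1) ^ 2 := by
    rw [← mul_pow, modChart_zero_mul_one]
  unfold ellEf
  rw [hk, modChart_one, one_sub_tS_sq, one_sub_tS_sq, ← div_pow,
    Real.sqrt_sq (div_pos (tC_pos hu0.le hu1) (tC_pos hx0.le hx1)).le]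

/-- **`dk dt/√((1-t²)(1-k²t²)) = W(xy) dy dx`**: the pulled-back `K`-form is `2/(1+x²y²)`. -/
theorem tW_eq_ellKf_modChart_mul {p : Fin 2 → ℝ} (hp : p ∈ kzOpenBox 2) :
    tW (p 0 * p 1) = ellKf (modChart p 0 ^ 2) (modChart p 1) * modJac p := by
  obtain ⟨⟨hy0, hy1⟩, ⟨hx0, hx1⟩, hu0, hu1⟩ := mem_kzOpenBox_two hp
  rw [ellKf_modChart hp, modJac, modA]
  have h1 : (1 : ℝ) - p 1 ^ 2 ≠ 0 := by nlinarith
  have h2 : (1 : ℝ) - (p 0 * p 1) ^ 2 ≠ 0 := by nlinarith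
  have h3 : (1 : ℝ) + p 1 ^ 2 ≠ 0 := by positivity
  have h4 : (1 : ℝ) + (p 0 * p 1) ^ 2 ≠ 0 := by positivity
  have h5 : (1 : ℝ) + p 0 ^ 2 * p 1 ^ 2 ≠ 0 := by positivity
  simp only [tC, tW]
  rw [mul_pow] at h2 h4
  field_simp

/-- **`√((1-k²t²)/(1-t²)) dk dt = C(xy)² W(xy) dy dx`**: the pulled-back `E`-form. -/
theorem tC_sq_mul_tW_eq_ellEf_modChart_mul {p : Fin 2 → ℝ} (hp : p ∈ kzOpenBox 2) :
    tC (p 0 * p 1) ^ 2 * tW (p 0 * p 1) = ellEf (modChart p 0 ^ 2) (modChart p 1) * modJac p := by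
  obtain ⟨⟨hy0, hy1⟩, ⟨hx0, hx1⟩, hu0, hu1⟩ := mem_kzOpenBox_two hp
  rw [ellEf_modChart hp, modJac, modA]
  have h1 : (1 : ℝ) - p 1 ^ 2 ≠ 0 := by nlinarith
  have h2 : (1 : ℝ) - (p 0 * p 1) ^ 2 ≠ 0 := by nlinarith
  have h3 : (1 : ℝ) + p 1 ^ 2 ≠ 0 := by positivity
  have h4 : (1 : ℝ) + (p 0 * p 1) ^ 2 ≠ 0 := by positivity
  have h5 : (1 : ℝ) + p 0 ^ 2 * p 1 ^ 2 ≠ 0 := by positivity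
  simp only [tC, tW]
  rw [mul_pow] at h2 h4
  field_simp

end SoloBlind

end Summit.KontsevichZagierPeriods.KontsevichZagierPeriods.Theorems
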